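import Summits.Ventures.YMGap.RobustBall.ZTwoLayerGraph
import Summits.Ventures.YMGap.RobustBall.IsingSetDecay
import Summits.Ventures.YMGap.RobustBall.IsingBallB2Embed
import Literature.Probability.LatticeModels.TorusTwoPointDecay
import Literature.Probability.LatticeModels.IsingTransport
import HarnessLib

/-!
# RobustBall/IsingLayerBox — the Duminil-Copin–Tassion BOXES `Λ_R ⊂ ℤⁿ` inside the layer graph of the torus `(ℤ/L)^{n+1}`, and the layer two-point
# bound `⟨σ_b σ_t⟩ ≤ φ_β(Λ_R)^{⌊dist_j(t,b)/(R+1)⌋}` for EVERY box (rung ∞ of the `β`-ladder: gen 9's engine fed with DCT's own sets)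

HONEST FRAMING: venture file of the cell `pub-ymgap` (QuantumFields programme), track Y2 ROBUST-BALL / DS seat ds-4 (g11).  Finite statements about the
free-boundary nearest-neighbour Ising model (`β ≥ 0`, zero field) on the layer graph `layerGraph i H` of the discrete torus (`ZTwoLayerGraph`); no `SU(2)`
measure here (that is `CentreBlindSubcritical`); nothing about the continuum.

WHAT.  For a site `a` at a selected `i`-height, the box `Λ_R = [−R, R]ⁿ ⊂ ℤⁿ` EMBEDS into the layer of `a` (`boxEmb i a u = a + ∑_k u_k e_{i.succAbove k}`),
injectively on `Λ_M` for `2M < L` (`boxEmb_injOn`) and as an INDUCED copy of `ℤⁿ ∩ Λ_M` for `2M + 1 < L` (`layerGraph_adj_boxEmb_iff`); so (transport) the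
two-point functions of the layer model inside the image `boxSet R i a` ARE those of the free box (`isingTwoPoint_boxSet_eq`), every exit edge of the image is
the image of an exit edge of the box (`card_exits_boxEmb_le`), the Simon–Lieb certificate of `boxSet R i a` is AT MOST Duminil-Copin–Tassion's `φ_β(Λ_R)`
(`boxSet_certificate_le`, `2R + 2 ≤ L`), and the image has `dist_j`-radius `R` (`jDist_boxEmb_le`).  Gen 9's ladder engine
`IsingStar.isingTwoPoint_free_le_pow_of_certificate` with these sets (and `{a}`, certificate `0`, at unselected heights, where `a` is isolated) gives
**`isingTwoPoint_layer_le_dctIsingPhi_pow`**: `β ≥ 0`, `2R + 2 ≤ L`, `(R+1)k ≤ dist_j(t,b)` ⇒ `⟨σ_b σ_t⟩^∅_{univ;β} ≤ φ_β(Λ_R)^k` on `layerGraph i H`.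
The tree's `exists_dctIsingPhi_box_lt_one_of_lt_criticalBeta` (DCT sharpness, standard axioms) supplies a box with `φ_β(Λ_R) < 1` at EVERY `β < β_c(ℤⁿ)`.

References: H. Duminil-Copin, V. Tassion, Comm. Math. Phys. 343 (2016) 725, Lemma 2.7 and §2.1 (`φ_β(S)`); B. Simon, Comm. Math. Phys. 77 (1980) 111;
E. Lieb, Comm. Math. Phys. 77 (1980) 127.
-/

noncomputable section

open Finset
open Literature.Probability.LatticeModels
open Literature.MathematicalPhysics.QuantumFieldTheory

namespace Summit.Ventures.YMGap.RobustBall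

namespace ZTwo

open ZN

variable {n L : ℕ}

/-- The layer offset homomorphism `u ↦ ∑_k u_k e_{i.succAbove k}` from `ℤⁿ` into the torus sites (the `n` directions other than `i`). [folklore] -/
def layerOff (i : Fin (n + 1)) : (Fin n → ℤ) →+ Site (n + 1) L where
  toFun u := ∑ k : Fin n, Pi.single (i.succAbove k) ((u k : ℤ) : ZMod L)
  map_zero' := by simp
  map_add' u u' := by simp [Pi.single_add, sum_add_distrib]

/-- Unfolding `layerOff`. [folklore] -/
theorem layerOff_apply (i : Fin (n + 1)) (u : Fin n → ℤ) :
    layerOff (L := L) i u = ∑ k : Fin n, (Pi.single (i.succAbove k) ((u k : ℤ) : ZMod L) : Site (n + 1) L) := rfl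

/-- `layerOff` on a coordinate vector. [folklore] -/
theorem layerOff_single (i : Fin (n + 1)) (k : Fin n) (z : ℤ) :
    layerOff (L := L) i (Pi.single k z) = (Pi.single (i.succAbove k) ((z : ℤ) : ZMod L) : Site (n + 1) L) := by
  rw [layerOff_apply, Fintype.sum_eq_single k]
  · simp
  · intro k' hk'; simp [Pi.single_eq_of_ne hk']

/-- `layerOff u` has no `i`-component. [folklore] -/
theorem layerOff_apply_self (i : Fin (n + 1)) (u : Fin n → ℤ) : layerOff (L := L) i u i = 0 := by
  rw [layerOff_apply, Finset.sum_apply]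
  exact sum_eq_zero fun k _ => Pi.single_eq_of_ne (Fin.succAbove_ne i k).symm _

/-- The `i.succAbove k`-component of `layerOff u` is `u_k`. [folklore] -/
theorem layerOff_apply_succAbove (i : Fin (n + 1)) (u : Fin n → ℤ) (k : Fin n) :
    layerOff (L := L) i u (i.succAbove k) = ((u k : ℤ) : ZMod L) := by
  rw [layerOff_apply, Finset.sum_apply, Fintype.sum_eq_single k]
  · simp
  · intro k' hk'; exact Pi.single_eq_of_ne (fun h => hk' (Fin.succAbove_right_injective h).symm) _

/-- **Small integer vectors are determined by their image in the torus**: if `|u_k| < L` for all `k` and `layerOff u = 0` then `u = 0`. [folklore] -/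
theorem eq_zero_of_layerOff_eq_zero (i : Fin (n + 1)) {u : Fin n → ℤ} (hu : ∀ k, |u k| < (L : ℤ)) (h : layerOff (L := L) i u = 0) : u = 0 := by
  funext k
  have hk := congrFun h (i.succAbove k)
  rw [layerOff_apply_succAbove, Pi.zero_apply, ZMod.intCast_zmod_eq_zero_iff_dvd] at hk
  exact Int.eq_zero_of_abs_lt_dvd hk (hu k)

/-- **The embedding of the box around `a`**: `u ↦ a + ∑_k u_k e_{i.succAbove k}`. [folklore] -/
def boxEmb (i : Fin (n + 1)) (a : Site (n + 1) L) (u : Fin n → ℤ) : Site (n + 1) L := a + layerOff i u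

/-- The origin goes to `a`. [folklore] -/
@[simp] theorem boxEmb_zero (i : Fin (n + 1)) (a : Site (n + 1) L) : boxEmb i a 0 = a := by
  simp [boxEmb]

/-- The embedded box lies at the `i`-height of `a`. [folklore] -/
theorem boxEmb_apply_self (i : Fin (n + 1)) (a : Site (n + 1) L) (u : Fin n → ℤ) : boxEmb i a u i = a i := by
  simp [boxEmb, layerOff_apply_self]

/-- The `i.succAbove k`-coordinate of the embedded point. [folklore] -/
theorem boxEmb_apply_succAbove (i : Fin (n + 1)) (a : Site (n + 1) L) (u : Fin n → ℤ) (k : Fin n) :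
    boxEmb i a u (i.succAbove k) = a (i.succAbove k) + ((u k : ℤ) : ZMod L) := by
  simp [boxEmb, layerOff_apply_succAbove]

/-- A lattice step becomes a torus step: `boxEmb (u + z e_k) = boxEmb u + z e_{i.succAbove k}`. [folklore] -/
theorem boxEmb_add_single (i : Fin (n + 1)) (a : Site (n + 1) L) (u : Fin n → ℤ) (k : Fin n) (z : ℤ) :
    boxEmb i a (u + Pi.single k z) = boxEmb i a u + Pi.single (i.succAbove k) ((z : ℤ) : ZMod L) := by
  unfold boxEmb; rw [map_add, layerOff_single, add_assoc]

/-- **The embedding is injective on `Λ_M` for `2M < L`.** [folklore] -/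
theorem boxEmb_injOn {M : ℕ} (hML : 2 * M < L) (i : Fin (n + 1)) (a : Site (n + 1) L) :
    Set.InjOn (boxEmb i a) (box n M : Set (Fin n → ℤ)) := by
  intro u hu u' hu' h
  have h1 : layerOff (L := L) i (u - u') = 0 := by
    rw [map_sub, sub_eq_zero]; exact add_left_cancel h
  have h2 := eq_zero_of_layerOff_eq_zero i (fun k => ?_) h1
  · exact sub_eq_zero.1 h2
  · have := abs_sub_le_of_mem_box (Finset.mem_coe.1 hu) (Finset.mem_coe.1 hu') k
    have hL' : ((2 * M : ℕ) : ℤ) < L := by exact_mod_cast hML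
    push_cast at hL'; rw [Pi.sub_apply]; omega

/-- **The box `Λ_R(a)` in the layer**: the image of `Λ_R` under the embedding. [folklore] -/
def boxSet (R : ℕ) (i : Fin (n + 1)) (a : Site (n + 1) L) : Finset (Site (n + 1) L) := (box n R).image (boxEmb i a)

/-- The centre is in its box. [folklore] -/
theorem mem_boxSet_self (R : ℕ) (i : Fin (n + 1)) (a : Site (n + 1) L) : a ∈ boxSet R i a :=
  mem_image.2 ⟨0, zero_mem_box n R, boxEmb_zero i a⟩

section Layer

variable [NeZero L]

/-- Adjacent sites of the layer graph lie at a selected height (any dimension). [folklore] -/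
theorem adj_height_mem {i : Fin (n + 1)} {H : Finset (ZMod L)} {y y' : Site (n + 1) L} (h : (layerGraph i H).Adj y y') : y i ∈ H := by
  obtain ⟨-, h⟩ := layerGraph_adj.1 h
  rcases h with ⟨p, hp, rfl, -⟩ | ⟨p, hp, -, rfl⟩
  · exact (mem_layerPlaqs.1 hp).2
  · rw [Literature.MathematicalPhysics.QuantumFieldTheory.Site.shift, Pi.add_apply,
      Pi.single_eq_of_ne (otherDir_ne i p (mem_layerPlaqs.1 hp).1).symm, add_zero]
    exact (mem_layerPlaqs.1 hp).2

/-- **Sites at unselected heights are isolated.** [folklore] -/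
theorem not_adj_of_height_notMem {i : Fin (n + 1)} {H : Finset (ZMod L)} {y : Site (n + 1) L} (hy : y i ∉ H) (y' : Site (n + 1) L) :
    ¬(layerGraph i H).Adj y y' := fun h => hy (adj_height_mem h)

/-- **A unit step inside a selected layer is an edge of the layer graph** (`L ≥ 2`, `v ≠ i`, `y_i ∈ H`; any dimension). [folklore] -/
theorem layerAdj_shift (hL : 2 ≤ L) {i : Fin (n + 1)} {H : Finset (ZMod L)} {y : Site (n + 1) L} (hy : y i ∈ H) {v : Fin (n + 1)}
    (hv : v ≠ i) : (layerGraph i H).Adj y (y.shift v) := by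
  rw [layerGraph_adj]
  refine ⟨(Balaban1983to89.StrongCouplingTorusWindow.shift_ne_self (by omega) y v).symm, Or.inl ?_⟩
  rcases lt_or_gt_of_ne hv with h | h
  · refine ⟨(y, ⟨(v, i), h⟩), mem_layerPlaqs.2 ⟨Or.inr rfl, hy⟩, rfl, ?_⟩
    simp [otherDir, hv]
  · refine ⟨(y, ⟨(i, v), h⟩), mem_layerPlaqs.2 ⟨Or.inl rfl, hy⟩, rfl, ?_⟩
    simp [otherDir]

/-- A signed unit step inside a selected layer is an edge of the layer graph (any dimension). [folklore] -/
theorem layerAdj_add_single (hL : 2 ≤ L) {i : Fin (n + 1)} {H : Finset (ZMod L)} {y : Site (n + 1) L} (hy : y i ∈ H) {v : Fin (n + 1)}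
    (hv : v ≠ i) {ε : ZMod L} (hε : ε = 1 ∨ ε = -1) : (layerGraph i H).Adj y (y + Pi.single v ε) := by
  rcases hε with rfl | rfl
  · exact layerAdj_shift hL hy hv
  · have hy' : (y + (Pi.single v (-1 : ZMod L) : Site (n + 1) L)) i ∈ H := by
      rw [Pi.add_apply, Pi.single_eq_of_ne (Ne.symm hv), add_zero]; exact hy
    have h := layerAdj_shift hL hy' hv
    have hs : (y + (Pi.single v (-1 : ZMod L) : Site (n + 1) L)).shift v = y := by
      simp [Literature.MathematicalPhysics.QuantumFieldTheory.Site.shift, add_assoc, ← Pi.single_add]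
    rw [hs] at h
    exact h.symm

/-- **Every layer neighbour of an embedded point is the image of a lattice neighbour** (no size condition). [folklore] -/
theorem exists_boxEmb_of_adj {i : Fin (n + 1)} {H : Finset (ZMod L)} {a : Site (n + 1) L} {u : Fin n → ℤ} {y : Site (n + 1) L}
    (h : (layerGraph i H).Adj (boxEmb i a u) y) : ∃ w : Fin n → ℤ, (zdGraph n).Adj u w ∧ y = boxEmb i a w := by
  obtain ⟨v, hv, ε, hε, hy⟩ := exists_single_of_adj h
  obtain ⟨k, rfl⟩ := Fin.exists_succAbove_eq hv
  obtain ⟨e, he, rfl⟩ := exists_int_cast_of_sign hε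
  refine ⟨u + Pi.single k e, ?_, by rw [hy, boxEmb_add_single]⟩
  rw [zdGraph_adj_iff]
  rcases he with rfl | rfl
  · exact ⟨k, Or.inl rfl⟩
  · exact ⟨k, Or.inr (by rw [add_assoc, ← Pi.single_add]; simp)⟩

/-- **The embedded box `Λ_M` is an INDUCED copy of `ℤⁿ ∩ Λ_M`** (`2M + 1 < L`, `a` at a selected height). [folklore] -/
theorem layerGraph_adj_boxEmb_iff {M : ℕ} (hML : 2 * M + 1 < L) {i : Fin (n + 1)} {H : Finset (ZMod L)} {a : Site (n + 1) L} (ha : a i ∈ H)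
    {u u' : Fin n → ℤ} (hu : u ∈ box n M) (hu' : u' ∈ box n M) :
    (layerGraph i H).Adj (boxEmb i a u) (boxEmb i a u') ↔ (zdGraph n).Adj u u' := by
  have hL2 : 2 ≤ L := by omega
  constructor
  · intro h
    obtain ⟨v, hv, ε, hε, hq⟩ := exists_single_of_adj h
    obtain ⟨k, rfl⟩ := Fin.exists_succAbove_eq hv
    obtain ⟨e, he, rfl⟩ := exists_int_cast_of_sign hε
    -- `u' − u − e·e_k` vanishes in the torus, hence in `ℤⁿ`
    have h0 : layerOff (L := L) i (u' - u - Pi.single k e) = 0 := by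
      rw [map_sub, map_sub, layerOff_single]
      have := hq; unfold boxEmb at this
      rw [add_assoc] at this
      have h' := add_left_cancel this
      rw [h']; abel
    have hsmall : ∀ k', |(u' - u - Pi.single k e : Fin n → ℤ) k'| < (L : ℤ) := by
      intro k'
      have h1 := abs_sub_le_of_mem_box hu' hu k'
      have h3 : |(Pi.single k e : Fin n → ℤ) k'| ≤ 1 := by
        by_cases hk : k' = k
        · subst hk; rw [Pi.single_eq_same]; rcases he with rfl | rfl <;> simp
        · rw [Pi.single_eq_of_ne hk]; simp
      have hL' : ((2 * M + 1 : ℕ) : ℤ) < L := by exact_mod_cast hML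
      push_cast at hL'; simp only [Pi.sub_apply]
      have := abs_sub (u' k' - u k') ((Pi.single k e : Fin n → ℤ) k')
      omega
    have hz := eq_zero_of_layerOff_eq_zero i hsmall h0
    rw [sub_eq_zero, sub_eq_iff_eq_add'] at hz
    rw [zdGraph_adj_iff]
    rcases he with rfl | rfl
    · exact ⟨k, Or.inl hz⟩
    · exact ⟨k, Or.inr (by rw [hz, add_assoc, ← Pi.single_add]; simp)⟩
  · intro h
    have hpH : ∀ w : Fin n → ℤ, boxEmb i a w i ∈ H := fun w => by rw [boxEmb_apply_self]; exact ha
    obtain ⟨k, hk | hk⟩ := (zdGraph_adj_iff u u').1 h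
    · have : boxEmb i a u' = boxEmb i a u + Pi.single (i.succAbove k) (((1 : ℤ) : ℤ) : ZMod L) := by
        rw [hk, boxEmb_add_single]
      rw [this]
      exact layerAdj_add_single hL2 (hpH u) (Fin.succAbove_ne i k) (Or.inl (by simp))
    · have : boxEmb i a u = boxEmb i a u' + Pi.single (i.succAbove k) (((1 : ℤ) : ℤ) : ZMod L) := by
        rw [hk, boxEmb_add_single]
      rw [this]
      exact (layerAdj_add_single hL2 (hpH u') (Fin.succAbove_ne i k) (Or.inl (by simp))).symm

/-- **Transport: the two-point functions of the layer model inside `Λ_R(a)` are those of the free box `Λ_R ⊂ ℤⁿ`** (`2R + 1 < L`, `a` at a selected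
height; through the box as a vertex type, as in the tree's `isingTwoPoint_torus_image_box_eq`). [folklore] -/
theorem isingTwoPoint_boxSet_eq {R : ℕ} (hRL : 2 * R + 1 < L) {i : Fin (n + 1)} {H : Finset (ZMod L)} {a : Site (n + 1) L} (ha : a i ∈ H) (β : ℝ)
    {u u' : Fin n → ℤ} (hu : u ∈ box n R) (hu' : u' ∈ box n R) :
    isingTwoPoint (layerGraph i H) (boxSet R i a) β 0 .free (boxEmb i a u) (boxEmb i a u') =
      isingTwoPoint (zdGraph n) (box n R) β 0 .free u u' := by
  classical
  set S := ↥(box n R) with hS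
  let ι₁ : S ↪ (Fin n → ℤ) := Function.Embedding.subtype _
  let Gs : SimpleGraph S := (zdGraph n).comap ι₁
  have h1 : isingTwoPoint (zdGraph n) (box n R) β 0 .free u u' = isingTwoPoint Gs Finset.univ β 0 .free ⟨u, hu⟩ ⟨u', hu'⟩ := by
    have hmap : (Finset.univ : Finset S).map ι₁ = box n R := by
      rw [Finset.univ_eq_attach, Finset.attach_map_val]
    have := isingTwoPoint_free_map (G := Gs) (G' := zdGraph n) ι₁ (Λ := Finset.univ) (fun a _ b _ => Iff.rfl) β 0 ⟨u, hu⟩ ⟨u', hu'⟩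
    rw [hmap] at this
    exact this
  let ι₂ : S ↪ Site (n + 1) L :=
    ⟨fun s => boxEmb i a s.1, fun s s' hss' => Subtype.ext (boxEmb_injOn (M := R) (by omega) i a s.2 s'.2 hss')⟩
  have hadj : ∀ s ∈ (Finset.univ : Finset S), ∀ s' ∈ (Finset.univ : Finset S), ((layerGraph i H).Adj (ι₂ s) (ι₂ s') ↔ Gs.Adj s s') :=
    fun s _ s' _ => layerGraph_adj_boxEmb_iff hRL ha s.2 s'.2
  have hmap₂ : (Finset.univ : Finset S).map ι₂ = boxSet R i a := by
    ext y
    simp only [Finset.mem_map, Finset.mem_univ, true_and, boxSet, Finset.mem_image]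
    constructor
    · rintro ⟨s, rfl⟩; exact ⟨s.1, s.2, rfl⟩
    · rintro ⟨w, hw, rfl⟩; exact ⟨⟨w, hw⟩, rfl⟩
  have h2 : isingTwoPoint Gs Finset.univ β 0 .free ⟨u, hu⟩ ⟨u', hu'⟩ =
      isingTwoPoint (layerGraph i H) (Finset.univ.map ι₂) β 0 .free (boxEmb i a u) (boxEmb i a u') :=
    (isingTwoPoint_free_map (G := Gs) (G' := layerGraph i H) ι₂ hadj β 0 ⟨u, hu⟩ ⟨u', hu'⟩).symm
  rw [← hmap₂, ← h2, ← h1]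

/-- **Exits of the embedded box are images of exits of the box**: for `u ∈ Λ_R`, the layer neighbours of `boxEmb u` outside `Λ_R(a)` are at most as many
as the lattice neighbours of `u` outside `Λ_R`. [folklore] -/
theorem card_exits_boxEmb_le {R : ℕ} {i : Fin (n + 1)} {H : Finset (ZMod L)} (a : Site (n + 1) L) (u : Fin n → ℤ) :
    ((Finset.univ \ boxSet R i a).filter ((layerGraph i H).Adj (boxEmb i a u))).card ≤
      (((zdGraph n).neighborFinset u).filter (fun w => w ∉ box n R)).card := by
  classical
  -- choose, for every exit `y`, a lattice neighbour `w` of `u` with `boxEmb w = y`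
  have hex : ∀ y ∈ (Finset.univ \ boxSet R i a).filter ((layerGraph i H).Adj (boxEmb i a u)),
      ∃ w : Fin n → ℤ, (zdGraph n).Adj u w ∧ y = boxEmb i a w := fun y hy => exists_boxEmb_of_adj (mem_filter.1 hy).2
  refine Finset.card_le_card_of_injOn (fun y => if hy : y ∈ (Finset.univ \ boxSet R i a).filter ((layerGraph i H).Adj (boxEmb i a u))
      then Classical.choose (hex y hy) else 0) (fun y hy => ?_) (fun y hy y' hy' hyy' => ?_)
  · have hspec := Classical.choose_spec (hex y hy)
    rw [Finset.mem_coe] at hy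
    simp only [hy, dite_true, Finset.mem_coe, mem_filter, SimpleGraph.mem_neighborFinset]
    refine ⟨hspec.1, fun hw => ?_⟩
    have hyS : y ∉ boxSet R i a := (mem_sdiff.1 (mem_filter.1 hy).1).2
    exact hyS (hspec.2 ▸ mem_image_of_mem _ hw)
  · rw [Finset.mem_coe] at hy hy'
    have h1 := (Classical.choose_spec (hex y hy)).2
    have h2 := (Classical.choose_spec (hex y' hy')).2
    simp only [hy, hy', dite_true] at hyy'
    rw [h1, h2, hyy']

/-- **THE CERTIFICATE OF THE EMBEDDED BOX IS AT MOST `φ_β(Λ_R)`** (`β ≥ 0`, `2R + 2 ≤ L`, `a` at a selected height):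
`∑_{x ∈ Λ_R(a)} ∑_{y ∉ Λ_R(a), y ∼ x} tanh β ⟨σ_a σ_x⟩^∅_{Λ_R(a);β} ≤ φ_β(Λ_R)` (Duminil-Copin–Tassion's functional of the box in `ℤⁿ`).
[cite: DuminilCopinTassionCMP2016, §2.1, eq. (2.1)] -/
theorem boxSet_certificate_le {β : ℝ} (hβ : 0 ≤ β) {R : ℕ} (hRL : 2 * R + 2 ≤ L) {i : Fin (n + 1)} {H : Finset (ZMod L)} {a : Site (n + 1) L}
    (ha : a i ∈ H) :
    ∑ x ∈ boxSet R i a, ∑ _y ∈ (Finset.univ \ boxSet R i a).filter ((layerGraph i H).Adj x),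
        Real.tanh β * isingTwoPoint (layerGraph i H) (boxSet R i a) β 0 .free a x ≤ dctIsingPhi n β (box n R) := by
  classical
  have ht0 : 0 ≤ Real.tanh β := by
    rw [Real.tanh_eq_sinh_div_cosh]; exact div_nonneg (Real.sinh_nonneg_iff.2 hβ) (Real.cosh_pos β).le
  rw [dctIsingPhi_def, boxSet, Finset.sum_image (boxEmb_injOn (M := R) (by omega) i a)]
  refine Finset.sum_le_sum fun u hu => ?_
  rw [Finset.sum_const, Finset.sum_const, nsmul_eq_mul, nsmul_eq_mul]
  have heq : isingTwoPoint (layerGraph i H) ((box n R).image (boxEmb i a)) β 0 .free a (boxEmb i a u) =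
      isingTwoPoint (zdGraph n) (box n R) β 0 .free 0 u := by
    have key := isingTwoPoint_boxSet_eq (R := R) (by omega) ha β (zero_mem_box n R) hu
    rw [boxEmb_zero] at key; exact key
  rw [heq]
  have hnn : 0 ≤ Real.tanh β * isingTwoPoint (zdGraph n) (box n R) β 0 .free 0 u :=
    mul_nonneg ht0 (DCPLower.isingTwoPoint_free_nonneg_of_mem (zdGraph n) hβ (zero_mem_box n R) hu)
  exact mul_le_mul_of_nonneg_right (by exact_mod_cast card_exits_boxEmb_le (R := R) (H := H) a u) hnn

omit [NeZero L] in
/-- `dist_j` only reads the `j`-coordinate. [folklore] -/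
theorem jDist_congr_apply (j : Fin (n + 1)) (t : Site (n + 1) L) {y y' : Site (n + 1) L} (h : y j = y' j) : jDist j t y = jDist j t y' := by
  unfold jDist; rw [h]

/-- Adding `m` to a coordinate raises the profile of the ORIGINAL point by at most `m` relative to the new one: `dist_j(t,y) ≤ dist_j(t, y + m e_v) + m`.
[folklore] -/
theorem jDist_le_add_natCast (j : Fin (n + 1)) (t y : Site (n + 1) L) (v : Fin (n + 1)) (m : ℕ) :
    jDist j t y ≤ jDist j t (y + Pi.single v ((m : ℕ) : ZMod L)) + m := by
  induction m with
  | zero => simp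
  | succ m ih =>
      have h := jDist_le_shift j t (y + Pi.single v ((m : ℕ) : ZMod L)) v
      have hs : (y + Pi.single v ((m : ℕ) : ZMod L)).shift v = y + Pi.single v (((m + 1 : ℕ) : ℕ) : ZMod L) := by
        rw [Literature.MathematicalPhysics.QuantumFieldTheory.Site.shift, add_assoc, ← Pi.single_add]
        push_cast; rfl
      rw [hs] at h; omega

/-- `dist_j(t,y) ≤ dist_j(t, y − m e_v) + m`. [folklore] -/
theorem jDist_le_sub_natCast (j : Fin (n + 1)) (t y : Site (n + 1) L) (v : Fin (n + 1)) (m : ℕ) :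
    jDist j t y ≤ jDist j t (y + Pi.single v (-((m : ℕ) : ZMod L))) + m := by
  induction m with
  | zero => simp
  | succ m ih =>
      have h := jDist_shift_le j t (y + Pi.single v (-(((m + 1 : ℕ) : ℕ) : ZMod L))) v
      have hs : (y + Pi.single v (-(((m + 1 : ℕ) : ℕ) : ZMod L))).shift v = y + Pi.single v (-((m : ℕ) : ZMod L)) := by
        rw [Literature.MathematicalPhysics.QuantumFieldTheory.Site.shift, add_assoc, ← Pi.single_add]
        congr 2; push_cast; ring
      rw [hs] at h; omega

/-- `dist_j(t,y) ≤ dist_j(t, y + z e_v) + |z|` for an integer `z`. [folklore] -/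
theorem jDist_le_add_intCast (j : Fin (n + 1)) (t y : Site (n + 1) L) (v : Fin (n + 1)) (z : ℤ) :
    jDist j t y ≤ jDist j t (y + Pi.single v ((z : ℤ) : ZMod L)) + z.natAbs := by
  obtain ⟨m, rfl | rfl⟩ := Int.eq_nat_or_neg z
  · rw [Int.natAbs_natCast, Int.cast_natCast]
    exact jDist_le_add_natCast j t y v m
  · rw [Int.natAbs_neg, Int.natAbs_natCast, Int.cast_neg, Int.cast_natCast]
    exact jDist_le_sub_natCast j t y v m

/-- **The embedded box has `dist_j`-radius `R`**: `dist_j(t, a) ≤ dist_j(t, x) + R` for every `x ∈ Λ_R(a)`. [folklore] -/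
theorem jDist_boxEmb_le {R : ℕ} (j : Fin (n + 1)) (t : Site (n + 1) L) (i : Fin (n + 1)) (a : Site (n + 1) L) {u : Fin n → ℤ}
    (hu : u ∈ box n R) : jDist j t a ≤ jDist j t (boxEmb i a u) + R := by
  by_cases hj : j = i
  · subst hj
    rw [jDist_congr_apply j t (boxEmb_apply_self j a u)]
    omega
  · obtain ⟨k, rfl⟩ := Fin.exists_succAbove_eq hj
    have hco : boxEmb i a u (i.succAbove k) =
        (a + (Pi.single (i.succAbove k) (((u k : ℤ) : ℤ) : ZMod L) : Site (n + 1) L)) (i.succAbove k) := by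
      rw [boxEmb_apply_succAbove, Pi.add_apply, Pi.single_eq_same]
    rw [jDist_congr_apply _ t hco]
    have h := jDist_le_add_intCast (i.succAbove k) t a (i.succAbove k) (u k)
    have := (mem_box.1 hu) k
    omega

/-- **LAYER TWO-POINT DECAY FROM ANY DUMINIL-COPIN–TASSION BOX** (`β ≥ 0`, `2R + 2 ≤ L`): on `layerGraph i H`, for every `j`, `t` and every `b` with
`(R+1) k ≤ dist_j(t, b)`: `⟨σ_b σ_t⟩^∅_{univ;β} ≤ φ_β(Λ_R)^k`.  The ladder engine `IsingStar.isingTwoPoint_free_le_pow_of_certificate` with the sets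
`S_a = Λ_R(a)` (certificate `≤ φ_β(Λ_R)`, `boxSet_certificate_le`) at selected heights and `S_a = {a}` (certificate `0`: `a` is isolated) elsewhere.
[cite: DuminilCopinTassionCMP2016, Lemma 2.7 and §2.5] -/
theorem isingTwoPoint_layer_le_dctIsingPhi_pow {β : ℝ} (hβ : 0 ≤ β) {R : ℕ} (hRL : 2 * R + 2 ≤ L) (i j : Fin (n + 1)) (H : Finset (ZMod L))
    (t : Site (n + 1) L) :
    ∀ (k : ℕ) (b : Site (n + 1) L), (R + 1) * k ≤ jDist j t b →
      isingTwoPoint (layerGraph i H) Finset.univ β 0 .free b t ≤ dctIsingPhi n β (box n R) ^ k := by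
  classical
  have hφ0 : 0 ≤ dctIsingPhi n β (box n R) :=
    dctIsingPhi_nonneg (fun {_ _ _ _ _} => GriffithsKellySherman.gks_one_holds (zdGraph n)) hβ (zero_mem_box n R)
  set S : Site (n + 1) L → Finset (Site (n + 1) L) := fun a => if a i ∈ H then boxSet R i a else {a} with hS
  have hmain := IsingStar.isingTwoPoint_free_le_pow_of_certificate (layerGraph i H) hβ (Λ := Finset.univ) S R
    (φ₀ := dctIsingPhi n β (box n R)) (fun a _ => Finset.subset_univ _) (fun a _ => ?_) (jDist j t) (fun a _ x hx => ?_) (fun y y' h => jDist_le_of_adj j t h) (jDist_self j t)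
    (Finset.mem_univ t) (fun a _ => ?_)
  · intro k b hk
    exact hmain k b (Finset.mem_univ b) hk
  · -- `a ∈ S a`
    simp only [hS]
    split_ifs with ha
    · exact mem_boxSet_self R i a
    · exact mem_singleton_self a
  · -- radius
    simp only [hS] at hx
    split_ifs at hx with ha
    · obtain ⟨u, hu, rfl⟩ := mem_image.1 hx
      exact jDist_boxEmb_le j t i a hu
    · rw [mem_singleton.1 hx]; omega
  · -- certificate
    simp only [hS]
    split_ifs with ha
    · exact boxSet_certificate_le hβ hRL ha
    · rw [sum_singleton]
      have hempty : (Finset.univ \ {a}).filter ((layerGraph i H).Adj a) = ∅ :=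
        filter_eq_empty_iff.2 fun y _ => not_adj_of_height_notMem ha y
      rw [hempty, sum_empty]
      exact hφ0

end Layer

end ZTwo

end Summit.Ventures.YMGap.RobustBall

end
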